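import Mathlib
import Literature.MathematicalPhysics.QuantumFieldTheory.YangMillsOS
import Summits.QuantumFields.YangMills.Theorems.LangevinControlUVOSLegsFromFemtoAndGapStubAssemblyLatticeDist
import HarnessLib

/-!
# `ContinuumLegGivenGap` (stmt-QuantumFields-15828), line `Sketch` (reshape 10): `stub_lskBridge`

Support file for the crux item stmt-QuantumFields-15828 (registered stub `stub_lskBridge` of line
`Sketch`, reshape 10): **the socket's smeared functional IS the renormalised lattice distribution of
route LangevinControlUV's soft-assembly toolkit**.

The compactness socket stmt-15926 reads the smeared torus `n`-point functional of the renormalised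
curvature `P = r.curvature.F` at step `k` of a scheme `sch`,
  `LS k n F = ∫ ∑_{x ∈ (box L_k)ⁿ} F(a_k x) ∏ᵢ (c_k a_k⁴ (P(τ_{xᵢ} Ũ) − m_k)) dμ_{β_k, 2L_k+1}(U)`,
while the toolkit (`OSLegsFromFemtoAndGap.latticeDist`) works with the finite atomic functional
  `F ↦ ∑_{x ∈ (box L_k)ⁿ} W(x) F(a_k x)`, `W(x) = ∫ ∏ᵢ (P(τ_{xᵢ} Ũ) − m_k) dμ_{β_k, 2L_k+1}(U)`.
`stub_lskBridge` is the identity `LS k n F = (c_k a_k⁴)ⁿ · latticeDist … F` with both sides unfolded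
(for ANY additive normalisation `m_k`).

**Proof.** Pointwise in `U`, `∏ᵢ (c a⁴ (Pᵢ − m)) = (c a⁴)ⁿ ∏ᵢ (Pᵢ − m)` (`Finset.prod_mul_distrib`,
`Finset.prod_const`); the finite sum and the constants leave the integral (`integral_finsetSum`, each
summand integrable because the centred products of the bounded measurable curvature are integrable for
the probability measure `wilsonMeasure`, toolkit `integrable_prod_obs`; `integral_const_mul`,
`integral_complex_ofReal`); finally the sum over functions `x : Fin n → ↥(box 4 L_k)` is re-indexed as
the sum over `x ∈ Fintype.piFinset (fun _ => box 4 L_k)` (`Finset.sum_bij'` with the coercion and its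
inverse `y ↦ (i ↦ ⟨y i, _⟩)`). The torus side `sch.side k = 2 L_k + 1` holds by `rfl`. [folklore]
-/

noncomputable section

namespace Summit.QuantumFields.YangMills.Theorems.ContinuumLegGivenGap

open scoped SchwartzMap
open Filter Topology MeasureTheory
open Literature.MathematicalPhysics.QuantumFieldTheory Literature.MathematicalPhysics.QuantumLattice
  Literature.MathematicalPhysics.AQFT Literature.Probability.LatticeModels
open Summit.QuantumFields.YangMills.Theorems.OSLegsFromFemtoAndGap (integrable_prod_obs)

/-- `stub_lskBridge` — **the socket's functional IS the renormalised lattice distribution of route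
LangevinControlUV's toolkit** (registered stub of stmt-QuantumFields-15828, line `Sketch`, reshape 10):
`LS_k n F = (c_k a_k⁴)ⁿ · latticeDist r.ρ β_k L_k a_k P m_k n F` for the curvature `P = r.curvature.F` and
ANY additive normalisation `m_k`, stated with both sides unfolded (finite sums under the integral of a
probability measure, `side = 2L+1`). [folklore] -/
theorem stub_lskBridge :
    ∀ (G : Type) [Group G] [TopologicalSpace G] [IsTopologicalGroup G] [CompactSpace G]
      [MeasurableSpace G] [BorelSpace G] (r : LatticeRep G) (sch : SpeciesScheme (YMSpecies G)) (k n : ℕ)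
      (F : SchwartzMap (Fin n → EuclideanSpace ℝ (Fin 4)) ℂ),
      ∫ U : GaugeConfig 4 (sch.side k) G, ∑ x : Fin n → ↥(box 4 (sch.L k)),
          F (fun i => sch.a k • siteToE ↑(x i)) *
            ∏ i, ((sch.c r.curvature k * sch.a k ^ 4 *
              (r.curvature.F (configShift (-↑(x i)) (torusLift (sch.side k) U)) - sch.m r.curvature k) : ℝ) : ℂ)
          ∂(wilsonMeasure r.ρ (sch.β k)) =
        (((sch.c r.curvature k * sch.a k ^ 4) ^ n : ℝ) : ℂ) *
          ∑ x ∈ Fintype.piFinset (fun _ : Fin n => box 4 (sch.L k)),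
            ((∫ U : GaugeConfig 4 (sch.side k) G,
                ∏ i, (r.curvature.F (configShift (-(x i)) (torusLift (sch.side k) U)) - sch.m r.curvature k)
                ∂(wilsonMeasure r.ρ (sch.β k)) : ℝ) : ℂ) * F (fun i => sch.a k • siteToE (x i)) := by
  intro G _ _ _ _ _ _ r sch k n F
  classical
  -- (1) pointwise: the constants leave the product
  have hprod : ∀ (y : Fin n → Site 4) (U : GaugeConfig 4 (sch.side k) G),
      ∏ i, ((sch.c r.curvature k * sch.a k ^ 4 *
          (r.curvature.F (configShift (-(y i)) (torusLift (sch.side k) U)) - sch.m r.curvature k) : ℝ) : ℂ) =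
        (((sch.c r.curvature k * sch.a k ^ 4) ^ n : ℝ) : ℂ) *
          ((∏ i, (r.curvature.F (configShift (-(y i)) (torusLift (sch.side k) U)) - sch.m r.curvature k) : ℝ) :
            ℂ) := by
    intro y U
    rw [← Complex.ofReal_prod, ← Complex.ofReal_mul, Finset.prod_mul_distrib, Finset.prod_const,
      Finset.card_univ, Fintype.card_fin]
  -- (2) integrability of the centred products (probability measure, bounded measurable observable)
  have hint : ∀ y : Fin n → Site 4, Integrable (fun U : GaugeConfig 4 (sch.side k) G =>
      ∏ i, (r.curvature.F (configShift (-(y i)) (torusLift (sch.side k) U)) - sch.m r.curvature k))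
      (wilsonMeasure (d := 4) (L := sch.side k) r.ρ (sch.β k)) := fun y =>
    integrable_prod_obs r (sch.β k) (sch.L k) r.curvature (sch.m r.curvature k) y
  -- rewrite the integrand of the left-hand side
  have hlhs : (fun U : GaugeConfig 4 (sch.side k) G => ∑ x : Fin n → ↥(box 4 (sch.L k)),
      F (fun i => sch.a k • siteToE ↑(x i)) *
        ∏ i, ((sch.c r.curvature k * sch.a k ^ 4 *
          (r.curvature.F (configShift (-↑(x i)) (torusLift (sch.side k) U)) - sch.m r.curvature k) : ℝ) : ℂ)) =
      fun U => ∑ x : Fin n → ↥(box 4 (sch.L k)),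
        (F (fun i => sch.a k • siteToE ↑(x i)) * (((sch.c r.curvature k * sch.a k ^ 4) ^ n : ℝ) : ℂ)) *
          ((∏ i, (r.curvature.F (configShift (-↑(x i)) (torusLift (sch.side k) U)) - sch.m r.curvature k) :
            ℝ) : ℂ) := by
    funext U
    refine Finset.sum_congr rfl fun x _ => ?_
    rw [hprod (fun i => (↑(x i) : Site 4)) U, mul_assoc]
  rw [hlhs, integral_finsetSum _ (fun x _ => ((hint fun i => (↑(x i) : Site 4)).ofReal.const_mul _))]
  simp only [integral_const_mul, integral_complex_ofReal]
  -- (3) re-index the sum over functions into the box as the sum over `Fintype.piFinset`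
  rw [Finset.mul_sum]
  refine Finset.sum_bij' (fun (x : Fin n → ↥(box 4 (sch.L k))) _ => fun i => (↑(x i) : Site 4))
    (fun (y : Fin n → Site 4) hy => fun i => (⟨y i, Fintype.mem_piFinset.1 hy i⟩ : ↥(box 4 (sch.L k))))
    (fun x _ => Fintype.mem_piFinset.2 fun i => (x i).2) (fun y _ => Finset.mem_univ _)
    (fun x _ => rfl) (fun y _ => rfl) (fun x _ => ?_)
  ring

end Summit.QuantumFields.YangMills.Theorems.ContinuumLegGivenGap

end
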